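import Mathlib
import Literature.LinearAlgebra.Matrix.SpecialLinearReductionSurjective
import Summits.BirchSwinnertonDyer.BirchSwinnertonDyer.Theorems.KatoDescentTamePotSupersingularTameLowerFibreAdjointBricksFiveDet

/-!
# Bricks for the `GL₂(𝔽₅)`-lifting route (T5′), III: [M] Prop. 3.6 at `(5, 𝔽₅)` for every level

Continuation of `…TameLowerFibreAdjointBricksFive{,Det}` (same namespace). [M] Prop. 3.6
(Manoharmayum, Proc. AMS 143 (2015), arXiv:1304.1196; `|k| ≥ 4`): inflation
`H¹(SL₂(W_m), M₀) → H¹(SL₂(W_{m+1}), M₀)` is an isomorphism for all `m ≥ 1`; ARM-P audit r07 S7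
ADDENDUM-1 §C (C3)(d) consumes it at `(5, 𝔽₅)` together with `H¹(GL₂(𝔽₅), 𝔰𝔩₂) = 0` (p532773).
`cocycle_eq_zero_of_map_eq_one`: for every `m ≥ 1`, a 1-cocycle `f : SL₂(ℤ/5^{m+1}) → 𝔰𝔩₂(𝔽₅)`
(adjoint action through reduction mod `5`) VANISHES on `K = ker(SL₂(ℤ/5^{m+1}) → SL₂(ℤ/5^m))`, so
it is inflated from level `m` (inflation onto on cocycles; always injective on `H¹`). Proof, with
no cohomology library: `K = {1 + 5^m X} ≅ 𝔰𝔩₂(𝔽₅)` equivariantly, `f|_K` is an equivariant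
endomorphism, hence `c·id` by Schur (file II); if `c ≠ 0` the zero set of `f` is a complement of
`K`, i.e. a homomorphic section of `SL₂(ℤ/5^{m+1}) → SL₂(ℤ/5^m)` (lifts by Andrianov–Zhuravlev,
tree theorem `Literature.LinearAlgebra.Matrix.IntegerSpecialLinear.exists_specialLinearGroup_map_intCast_eq`),
forbidden by `not_exists_section_SL2` (file I = [M] Prop. 3.7); so `c = 0`. With files I–II and
p532773 every input of (T5′) specific to `(2, 5, 𝔽₅)` is now a kernel theorem; [M]'s general group
theory (Prop. 2.2, Claim 4.3, the Artinian limit) remains on paper. Route-free, no definitions,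
nothing about elliptic curves or items 19618/19981 (open). Target T-S7r07-1 (`FibreLatticeInput 5`).
-/

set_option linter.dupNamespace false

open Matrix

namespace Summit.BirchSwinnertonDyer.BirchSwinnertonDyer.Theorems.GL2F5AdjointBricks

section prop36

set_option maxHeartbeats 400000 in
/-- **[M] Prop. 3.6 at `(p, k) = (5, 𝔽₅)`, every level, in cocycle form.** Let `m ≥ 1` and let
`f : SL₂(ℤ/5^{m+1}) → 𝔰𝔩₂(𝔽₅)` be a 1-cocycle for the adjoint action through reduction mod `5`
(`f(gh) = f(g) + ḡ f(h) ḡ⁻¹`). Then `f` vanishes identically on `K = ker(SL₂(ℤ/5^{m+1}) → SL₂(ℤ/5^m))`,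
i.e. `f` is inflated from level `m`: inflation `H¹(SL₂(ℤ/5^m), 𝔰𝔩₂) → H¹(SL₂(ℤ/5^{m+1}), 𝔰𝔩₂)` is
onto (it is always injective). Proof: `f|_K` is an `SL₂`-equivariant homomorphism
`K ≅ 𝔰𝔩₂(𝔽₅) → 𝔰𝔩₂(𝔽₅)`, hence `c·id` by Schur (`exists_eq_smul_of_commute_transvections`); if
`c ≠ 0` then `{g : f g = 0}` is a complement of `K`, i.e. a section of
`SL₂(ℤ/5^{m+1}) → SL₂(ℤ/5^m)` (using Andrianov–Zhuravlev's surjectivity of `SL₂(ℤ) → SL₂(ℤ/N)`,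
`Literature.LinearAlgebra.Matrix.IntegerSpecialLinear.exists_specialLinearGroup_map_intCast_eq`),
contradicting `not_exists_section_SL2`; so `c = 0`. -/
theorem cocycle_eq_zero_of_map_eq_one (m : ℕ) (hm : 1 ≤ m)
    (f : Matrix.SpecialLinearGroup (Fin 2) (ZMod (5 ^ (m + 1))) → Matrix (Fin 2) (Fin 2) (ZMod 5))
    (htr : ∀ g, Matrix.trace (f g) = 0)
    (hf : ∀ g h, f (g * h) = f g +
      ((Matrix.SpecialLinearGroup.map (ZMod.castHom (dvd_pow_self 5 (Nat.succ_ne_zero m)) (ZMod 5)) g :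
          Matrix.SpecialLinearGroup (Fin 2) (ZMod 5)) : Matrix (Fin 2) (Fin 2) (ZMod 5)) * f h *
      ((Matrix.SpecialLinearGroup.map (ZMod.castHom (dvd_pow_self 5 (Nat.succ_ne_zero m)) (ZMod 5)) g)⁻¹ :
          Matrix.SpecialLinearGroup (Fin 2) (ZMod 5)))
    (k : Matrix.SpecialLinearGroup (Fin 2) (ZMod (5 ^ (m + 1))))
    (hk : Matrix.SpecialLinearGroup.map (ZMod.castHom (pow_dvd_pow 5 m.le_succ) (ZMod (5 ^ m))) k = 1) :
    f k = 0 := by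
  classical
  have h25 : (2 : ZMod 5) ≠ 0 := by decide
  haveI : NeZero (5 ^ (m + 1)) := ⟨pow_ne_zero _ (by norm_num)⟩
  haveI : NeZero (5 ^ m) := ⟨pow_ne_zero _ (by norm_num)⟩
  haveI : Fact (Nat.Prime 5) := ⟨by norm_num⟩
  -- notation
  set ρ := Matrix.SpecialLinearGroup.map (n := Fin 2)
    (ZMod.castHom (dvd_pow_self 5 (Nat.succ_ne_zero m)) (ZMod 5)) with hρ
  set red := Matrix.SpecialLinearGroup.map (n := Fin 2)
    (ZMod.castHom (pow_dvd_pow 5 m.le_succ) (ZMod (5 ^ m))) with hred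
  set c5 := ZMod.castHom (dvd_pow_self 5 (Nat.succ_ne_zero m)) (ZMod 5) with hc5
  set cm := ZMod.castHom (pow_dvd_pow 5 m.le_succ) (ZMod (5 ^ m)) with hcm
  set π : ZMod (5 ^ (m + 1)) := (5 : ZMod (5 ^ (m + 1))) ^ m with hπ_def
  -- arithmetic of `π`
  have h0 : (5 : ZMod (5 ^ (m + 1))) ^ (m + 1) = 0 := by
    exact_mod_cast ZMod.natCast_self (5 ^ (m + 1))
  have hπ2 : π * π = 0 := by
    rw [hπ_def, ← pow_add]; exact pow_eq_zero_of_le (by omega) h0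
  have h5π : 5 * π = 0 := by rw [hπ_def, ← pow_succ', h0]
  have hπ5 : π * 5 = 0 := by rw [mul_comm, h5π]
  have hπcast : ((5 ^ m : ℕ) : ZMod (5 ^ (m + 1))) = π := by rw [hπ_def]; push_cast; rfl
  have hc5π : c5 π = 0 := by
    rw [hπ_def, map_pow, map_ofNat, show (5 : ZMod 5) = 0 from rfl, zero_pow (by omega)]
  have hcmπ : cm π = 0 := by
    rw [hπ_def, map_pow, map_ofNat]
    exact_mod_cast ZMod.natCast_self (5 ^ m)
  -- (L) `π` kills differences of lifts; `π y = 0 ⇒ y ≡ 0 (mod 5)`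
  have L : ∀ y y' : ZMod (5 ^ (m + 1)), c5 y = c5 y' → π * y = π * y' := by
    intro y y' h
    have hz : c5 (y - y') = 0 := by rw [map_sub, h, sub_self]
    obtain ⟨t, ht⟩ := exists_eq_mul_of_cast_eq_zero _ _ hz
    rw [← sub_eq_zero, ← mul_sub, ht, ← mul_assoc, Nat.cast_ofNat, hπ5, zero_mul]
  have L' : ∀ y : ZMod (5 ^ (m + 1)), π * y = 0 → c5 y = 0 := by
    intro y hy
    have hdiv : 5 ^ (m + 1) ∣ 5 ^ m * y.val := by
      rw [← ZMod.natCast_eq_zero_iff, Nat.cast_mul, hπcast, ZMod.natCast_zmod_val]; exact hy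
    have h' : 5 ^ m * 5 ∣ 5 ^ m * y.val := (dvd_of_eq (pow_succ 5 m).symm).trans hdiv
    rw [← ZMod.natCast_zmod_val y, map_natCast, ZMod.natCast_eq_zero_iff]
    exact Nat.dvd_of_mul_dvd_mul_left (pow_pos (by norm_num) m) h'
  -- matrix forms of (L)
  have LM : ∀ Y Y' : Matrix (Fin 2) (Fin 2) (ZMod (5 ^ (m + 1))),
      (∀ i j, c5 (Y i j) = c5 (Y' i j)) → π • Y = π • Y' := by
    intro Y Y' h; ext i j; simp only [Matrix.smul_apply, smul_eq_mul]; exact L _ _ (h i j)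
  -- (0) cocycle basics
  have f_one : f 1 = 0 := by
    have := hf 1 1; simpa using this
  have hconj : ∀ g x : Matrix.SpecialLinearGroup (Fin 2) (ZMod (5 ^ (m + 1))), ρ x = 1 →
      f (g * x * g⁻¹) = (ρ g : Matrix (Fin 2) (Fin 2) (ZMod 5)) * f x * ((ρ g)⁻¹ :
        Matrix.SpecialLinearGroup (Fin 2) (ZMod 5)) := by
    intro g x hx
    have h1 := hf (g * x) g⁻¹
    have h2 := hf g x
    have h3 := hf g g⁻¹
    rw [mul_inv_cancel, f_one] at h3
    rw [h2, map_mul, hx, mul_one] at h1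
    rw [h1, eq_neg_of_add_eq_zero_right h3.symm]
    abel
  have hmulK : ∀ g x : Matrix.SpecialLinearGroup (Fin 2) (ZMod (5 ^ (m + 1))), ρ g = 1 →
      f (g * x) = f g + f x := by
    intro g x hg
    rw [hf, hg]; simp
  -- (1) the traceless lift `Λ X` of a matrix mod 5 (entry (1,1) forced) and `κ X = 1 + π Λ X ∈ K`
  let Λ : Matrix (Fin 2) (Fin 2) (ZMod 5) → Matrix (Fin 2) (Fin 2) (ZMod (5 ^ (m + 1))) := fun X =>
    !![((X 0 0).val : ZMod (5 ^ (m + 1))), ((X 0 1).val : ZMod (5 ^ (m + 1)));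
       ((X 1 0).val : ZMod (5 ^ (m + 1))), -((X 0 0).val : ZMod (5 ^ (m + 1)))]
  have hΛc : ∀ X : Matrix (Fin 2) (Fin 2) (ZMod 5), Matrix.trace X = 0 →
      ∀ i j, c5 (Λ X i j) = X i j := by
    intro X hX i j
    have hX11 : X 1 1 = -X 0 0 := by
      rw [Matrix.trace_fin_two] at hX; linear_combination hX
    fin_cases i <;> fin_cases j <;> simp [Λ, map_neg, hX11]
  have hdetΛ : ∀ X, Matrix.det (1 + π • Λ X) = 1 := by
    intro X
    simp only [Λ, Matrix.det_fin_two, Matrix.add_apply, Matrix.one_apply_eq, Matrix.one_apply_ne,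
      Matrix.smul_apply, smul_eq_mul, ne_eq, Fin.isValue, zero_ne_one, not_false_eq_true, one_ne_zero,
      Matrix.of_apply, Matrix.cons_val', Matrix.cons_val_zero, Matrix.cons_val_one,
      Matrix.cons_val_fin_one, Matrix.empty_val']
    linear_combination (-(((X 0 0).val : ZMod (5 ^ (m + 1)))) ^ 2
      - ((X 0 1).val : ZMod (5 ^ (m + 1))) * ((X 1 0).val : ZMod (5 ^ (m + 1)))) * hπ2
  let κ : Matrix (Fin 2) (Fin 2) (ZMod 5) → Matrix.SpecialLinearGroup (Fin 2) (ZMod (5 ^ (m + 1))) :=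
    fun X => ⟨1 + π • Λ X, hdetΛ X⟩
  have hκval : ∀ X, ((κ X : Matrix.SpecialLinearGroup (Fin 2) (ZMod (5 ^ (m + 1)))) :
      Matrix (Fin 2) (Fin 2) (ZMod (5 ^ (m + 1)))) = 1 + π • Λ X := fun X => rfl
  -- reductions of `κ X`
  have hρκ : ∀ X, ρ (κ X) = 1 := by
    intro X
    apply Subtype.ext
    rw [Matrix.SpecialLinearGroup.map_apply_coe, hκval, Matrix.SpecialLinearGroup.coe_one]
    ext i j
    rw [RingHom.mapMatrix_apply, Matrix.map_apply, Matrix.add_apply, Matrix.smul_apply, smul_eq_mul,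
      map_add, map_mul, hc5π, zero_mul, add_zero, Matrix.one_apply, Matrix.one_apply, apply_ite c5,
      map_one, map_zero]
  have hredκ : ∀ X, red (κ X) = 1 := by
    intro X
    apply Subtype.ext
    rw [Matrix.SpecialLinearGroup.map_apply_coe, hκval, Matrix.SpecialLinearGroup.coe_one]
    ext i j
    rw [RingHom.mapMatrix_apply, Matrix.map_apply, Matrix.add_apply, Matrix.smul_apply, smul_eq_mul,
      map_add, map_mul, hcmπ, zero_mul, add_zero, Matrix.one_apply, Matrix.one_apply, apply_ite cm,
      map_one, map_zero]
  -- `κ` is additive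
  have hκadd : ∀ X X', κ (X + X') = κ X * κ X' := by
    intro X X'
    apply Subtype.ext
    rw [Matrix.SpecialLinearGroup.coe_mul, hκval, hκval, hκval]
    have hsq : (π • Λ X) * (π • Λ X') = 0 := by
      rw [smul_mul_assoc, mul_smul_comm, smul_smul, hπ2, zero_smul]
    have hprod : (1 + π • Λ X) * (1 + π • Λ X') = 1 + (π • Λ X + π • Λ X') := by
      simp only [add_mul, mul_add, one_mul, mul_one, hsq, add_zero]
      abel
    rw [hprod, ← smul_add]
    congr 1
    apply LM
    intro i j
    rw [Matrix.add_apply, map_add]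
    fin_cases i <;> fin_cases j <;> simp [Λ, map_neg]
    all_goals ring
  have hκzero : κ 0 = 1 := by
    apply Subtype.ext
    rw [hκval, Matrix.SpecialLinearGroup.coe_one]
    have : Λ 0 = 0 := by
      ext i j; fin_cases i <;> fin_cases j <;> simp [Λ]
    rw [this, smul_zero, add_zero]
  -- every element of `K` is a `κ X` with `X` trace-zero
  have hK : ∀ x : Matrix.SpecialLinearGroup (Fin 2) (ZMod (5 ^ (m + 1))), red x = 1 →
      ∃ X : Matrix (Fin 2) (Fin 2) (ZMod 5), Matrix.trace X = 0 ∧ x = κ X := by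
    intro x hx
    have hent : ∀ i j, ∃ t : ZMod (5 ^ (m + 1)),
        (x : Matrix (Fin 2) (Fin 2) (ZMod (5 ^ (m + 1)))) i j =
          (1 : Matrix (Fin 2) (Fin 2) (ZMod (5 ^ (m + 1)))) i j + π * t := by
      intro i j
      have h := congrArg (fun g : Matrix.SpecialLinearGroup (Fin 2) (ZMod (5 ^ m)) =>
        (g : Matrix (Fin 2) (Fin 2) (ZMod (5 ^ m))) i j) hx
      simp only [hred, Matrix.SpecialLinearGroup.map_apply_coe, RingHom.mapMatrix_apply, Matrix.map_apply,
        Matrix.SpecialLinearGroup.coe_one] at h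
      have hz : cm ((x : Matrix (Fin 2) (Fin 2) (ZMod (5 ^ (m + 1)))) i j -
          (1 : Matrix (Fin 2) (Fin 2) (ZMod (5 ^ (m + 1)))) i j) = 0 := by
        rw [map_sub, h, sub_eq_zero, Matrix.one_apply, Matrix.one_apply, apply_ite cm, map_one, map_zero]
      obtain ⟨t, ht⟩ := exists_eq_mul_of_castHom_eq_zero m _ hz
      exact ⟨t, by rw [← sub_eq_iff_eq_add', ht, hπcast]⟩
    choose Y hY using hent
    have hxval : (x : Matrix (Fin 2) (Fin 2) (ZMod (5 ^ (m + 1)))) = 1 + π • Matrix.of Y := by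
      ext i j; rw [hY, Matrix.add_apply, Matrix.smul_apply, smul_eq_mul, Matrix.of_apply]
    -- trace condition from `det x = 1`
    have hdetx := x.prop
    rw [hxval, Matrix.det_fin_two] at hdetx
    simp only [Matrix.add_apply, Matrix.one_apply_eq, Matrix.one_apply_ne, Matrix.smul_apply, smul_eq_mul,
      ne_eq, Fin.isValue, zero_ne_one, not_false_eq_true, one_ne_zero, Matrix.of_apply, zero_add] at hdetx
    have htrY : π * (Y 0 0 + Y 1 1) = 0 := by
      linear_combination hdetx + (Y 0 1 * Y 1 0 - Y 0 0 * Y 1 1) * hπ2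
    refine ⟨c5.mapMatrix (Matrix.of Y), ?_, ?_⟩
    · rw [Matrix.trace_fin_two, RingHom.mapMatrix_apply, Matrix.map_apply, Matrix.map_apply, Matrix.of_apply,
        Matrix.of_apply, ← map_add]
      exact L' _ htrY
    · apply Subtype.ext
      rw [hxval, hκval]
      congr 1
      apply LM
      intro i j
      rw [hΛc _ (by
        rw [Matrix.trace_fin_two, RingHom.mapMatrix_apply, Matrix.map_apply, Matrix.map_apply, Matrix.of_apply,
          Matrix.of_apply, ← map_add]
        exact L' _ htrY)]
      rw [RingHom.mapMatrix_apply, Matrix.map_apply]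
  -- the integral transvections upstairs, their reductions and inverses
  let uS : Matrix.SpecialLinearGroup (Fin 2) (ZMod (5 ^ (m + 1))) :=
    ⟨!![1, 1; 0, 1], by simp [Matrix.det_fin_two]⟩
  let vS : Matrix.SpecialLinearGroup (Fin 2) (ZMod (5 ^ (m + 1))) :=
    ⟨!![1, 0; 1, 1], by simp [Matrix.det_fin_two]⟩
  have huval : ((uS : Matrix.SpecialLinearGroup (Fin 2) (ZMod (5 ^ (m + 1)))) :
      Matrix (Fin 2) (Fin 2) (ZMod (5 ^ (m + 1)))) = !![1, 1; 0, 1] := rfl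
  have hvval : ((vS : Matrix.SpecialLinearGroup (Fin 2) (ZMod (5 ^ (m + 1)))) :
      Matrix (Fin 2) (Fin 2) (ZMod (5 ^ (m + 1)))) = !![1, 0; 1, 1] := rfl
  have huinv : ((uS⁻¹ : Matrix.SpecialLinearGroup (Fin 2) (ZMod (5 ^ (m + 1)))) :
      Matrix (Fin 2) (Fin 2) (ZMod (5 ^ (m + 1)))) = !![1, -1; 0, 1] := by
    rw [Matrix.SpecialLinearGroup.coe_inv, huval, Matrix.adjugate_fin_two]
    ext i j; fin_cases i <;> fin_cases j <;> simp
  have hvinv : ((vS⁻¹ : Matrix.SpecialLinearGroup (Fin 2) (ZMod (5 ^ (m + 1)))) :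
      Matrix (Fin 2) (Fin 2) (ZMod (5 ^ (m + 1)))) = !![1, 0; -1, 1] := by
    rw [Matrix.SpecialLinearGroup.coe_inv, hvval, Matrix.adjugate_fin_two]
    ext i j; fin_cases i <;> fin_cases j <;> simp
  have hρu : ((ρ uS : Matrix.SpecialLinearGroup (Fin 2) (ZMod 5)) : Matrix (Fin 2) (Fin 2) (ZMod 5)) =
      !![1, 1; 0, 1] := by
    rw [hρ, Matrix.SpecialLinearGroup.map_apply_coe, huval]
    ext i j; fin_cases i <;> fin_cases j <;> simp [RingHom.mapMatrix_apply]
  have hρv : ((ρ vS : Matrix.SpecialLinearGroup (Fin 2) (ZMod 5)) : Matrix (Fin 2) (Fin 2) (ZMod 5)) =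
      !![1, 0; 1, 1] := by
    rw [hρ, Matrix.SpecialLinearGroup.map_apply_coe, hvval]
    ext i j; fin_cases i <;> fin_cases j <;> simp [RingHom.mapMatrix_apply]
  have hρuinv : (((ρ uS)⁻¹ : Matrix.SpecialLinearGroup (Fin 2) (ZMod 5)) : Matrix (Fin 2) (Fin 2) (ZMod 5)) =
      !![1, -1; 0, 1] := by
    rw [Matrix.SpecialLinearGroup.coe_inv, hρu, Matrix.adjugate_fin_two]
    ext i j; fin_cases i <;> fin_cases j <;> simp
  have hρvinv : (((ρ vS)⁻¹ : Matrix.SpecialLinearGroup (Fin 2) (ZMod 5)) : Matrix (Fin 2) (Fin 2) (ZMod 5)) =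
      !![1, 0; -1, 1] := by
    rw [Matrix.SpecialLinearGroup.coe_inv, hρv, Matrix.adjugate_fin_two]
    ext i j; fin_cases i <;> fin_cases j <;> simp
  -- `c5` on products and on `Λ X`
  have hc5Λ : ∀ X : Matrix (Fin 2) (Fin 2) (ZMod 5), Matrix.trace X = 0 → c5.mapMatrix (Λ X) = X := by
    intro X hX; ext i j; rw [RingHom.mapMatrix_apply, Matrix.map_apply]; exact hΛc X hX i j
  have hc5u : c5.mapMatrix (!![1, 1; 0, 1] : Matrix (Fin 2) (Fin 2) (ZMod (5 ^ (m + 1)))) = !![1, 1; 0, 1] := by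
    ext i j; fin_cases i <;> fin_cases j <;> simp [RingHom.mapMatrix_apply]
  have hc5u' : c5.mapMatrix (!![1, -1; 0, 1] : Matrix (Fin 2) (Fin 2) (ZMod (5 ^ (m + 1)))) = !![1, -1; 0, 1] := by
    ext i j; fin_cases i <;> fin_cases j <;> simp [RingHom.mapMatrix_apply]
  have hc5v : c5.mapMatrix (!![1, 0; 1, 1] : Matrix (Fin 2) (Fin 2) (ZMod (5 ^ (m + 1)))) = !![1, 0; 1, 1] := by
    ext i j; fin_cases i <;> fin_cases j <;> simp [RingHom.mapMatrix_apply]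
  have hc5v' : c5.mapMatrix (!![1, 0; -1, 1] : Matrix (Fin 2) (Fin 2) (ZMod (5 ^ (m + 1)))) = !![1, 0; -1, 1] := by
    ext i j; fin_cases i <;> fin_cases j <;> simp [RingHom.mapMatrix_apply]
  -- conjugating `κ X` by `uS`, `vS`
  have hκconj : ∀ (A A' : Matrix (Fin 2) (Fin 2) (ZMod (5 ^ (m + 1)))) (a a' : Matrix (Fin 2) (Fin 2) (ZMod 5)),
      A * A' = 1 → c5.mapMatrix A = a → c5.mapMatrix A' = a' →
      ∀ X : Matrix (Fin 2) (Fin 2) (ZMod 5), Matrix.trace X = 0 →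
        A * (1 + π • Λ X) * A' = 1 + π • Λ (a * X * a') := by
    intro A A' a a' hAA' hA hA' X hX
    have htr' : Matrix.trace (a * X * a') = 0 := by
      have haa' : a * a' = 1 := by rw [← hA, ← hA', ← map_mul, hAA', map_one]
      have ha'a : a' * a = 1 := mul_eq_one_comm.1 haa'
      rw [Matrix.mul_assoc, Matrix.trace_mul_comm, Matrix.mul_assoc, ha'a, Matrix.mul_one]; exact hX
    rw [mul_add, add_mul, mul_one, hAA', Matrix.mul_smul, Matrix.smul_mul]
    congr 1
    apply LM
    intro i j
    rw [hΛc _ htr' i j]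
    have h := congrArg (fun M : Matrix (Fin 2) (Fin 2) (ZMod 5) => M i j)
      (show c5.mapMatrix (A * Λ X * A') = a * X * a' by rw [map_mul, map_mul, hA, hA', hc5Λ X hX])
    simpa [RingHom.mapMatrix_apply] using h
  have huu' : (!![1, 1; 0, 1] : Matrix (Fin 2) (Fin 2) (ZMod (5 ^ (m + 1)))) * !![1, -1; 0, 1] = 1 := by
    rw [Matrix.mul_fin_two, Matrix.one_fin_two]; ext i j; fin_cases i <;> fin_cases j <;> simp
  have hvv' : (!![1, 0; 1, 1] : Matrix (Fin 2) (Fin 2) (ZMod (5 ^ (m + 1)))) * !![1, 0; -1, 1] = 1 := by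
    rw [Matrix.mul_fin_two, Matrix.one_fin_two]; ext i j; fin_cases i <;> fin_cases j <;> simp
  have hκu : ∀ X : Matrix (Fin 2) (Fin 2) (ZMod 5), Matrix.trace X = 0 →
      uS * κ X * uS⁻¹ = κ (!![1, 1; 0, 1] * X * !![1, -1; 0, 1]) := by
    intro X hX
    apply Subtype.ext
    rw [Matrix.SpecialLinearGroup.coe_mul, Matrix.SpecialLinearGroup.coe_mul, hκval, hκval, huinv, huval]
    exact hκconj _ _ _ _ huu' hc5u hc5u' X hX
  have hκv : ∀ X : Matrix (Fin 2) (Fin 2) (ZMod 5), Matrix.trace X = 0 →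
      vS * κ X * vS⁻¹ = κ (!![1, 0; 1, 1] * X * !![1, 0; -1, 1]) := by
    intro X hX
    apply Subtype.ext
    rw [Matrix.SpecialLinearGroup.coe_mul, Matrix.SpecialLinearGroup.coe_mul, hκval, hκval, hvinv, hvval]
    exact hκconj _ _ _ _ hvv' hc5v hc5v' X hX
  -- (2) `ψ = f ∘ κ` is additive, hence `𝔽₅`-linear, and `SL₂`-equivariant on `𝔰𝔩₂`
  let ψ₀ : Matrix (Fin 2) (Fin 2) (ZMod 5) →+ Matrix (Fin 2) (Fin 2) (ZMod 5) :=
    AddMonoidHom.mk' (fun X => f (κ X)) (fun X X' => by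
      show f (κ (X + X')) = f (κ X) + f (κ X')
      rw [hκadd, hmulK _ _ (hρκ X)])
  let ψ := ψ₀.toZModLinearMap 5
  have hψ : ∀ X, ψ X = f (κ X) := fun X => rfl
  have hψtr : ∀ X : Matrix (Fin 2) (Fin 2) (ZMod 5), Matrix.trace X = 0 → Matrix.trace (ψ X) = 0 :=
    fun X _ => by rw [hψ]; exact htr _
  have hψu : ∀ X : Matrix (Fin 2) (Fin 2) (ZMod 5), Matrix.trace X = 0 →
      ψ (!![1, 1; 0, 1] * X * !![1, -1; 0, 1]) = !![1, 1; 0, 1] * ψ X * !![1, -1; 0, 1] := by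
    intro X hX
    rw [hψ, hψ, ← hκu X hX, hconj _ _ (hρκ X), hρu, hρuinv]
  have hψv : ∀ X : Matrix (Fin 2) (Fin 2) (ZMod 5), Matrix.trace X = 0 →
      ψ (!![1, 0; 1, 1] * X * !![1, 0; -1, 1]) = !![1, 0; 1, 1] * ψ X * !![1, 0; -1, 1] := by
    intro X hX
    rw [hψ, hψ, ← hκv X hX, hconj _ _ (hρκ X), hρv, hρvinv]
  obtain ⟨c, hc⟩ := exists_eq_smul_of_commute_transvections (F := ZMod 5) h25 ψ hψtr hψu hψv
  -- (3) `f` on `K` is `c • (leading term)`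
  have hfK : ∀ x : Matrix.SpecialLinearGroup (Fin 2) (ZMod (5 ^ (m + 1))), red x = 1 →
      ∃ X : Matrix (Fin 2) (Fin 2) (ZMod 5), Matrix.trace X = 0 ∧ x = κ X ∧ f x = c • X := by
    intro x hx
    obtain ⟨X, hX, rfl⟩ := hK x hx
    exact ⟨X, hX, rfl, by rw [← hψ, hc X hX]⟩
  by_cases hc0 : c = 0
  · obtain ⟨X, -, -, hfx⟩ := hfK k hk
    rw [hfx, hc0, zero_smul]
  -- (4) `c ≠ 0`: `{g : f g = 0}` is a complement of `K` — build the section and contradict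
  exfalso
  -- uniqueness: two elements with the same reduction and `f = 0` coincide
  have hU : ∀ h h' : Matrix.SpecialLinearGroup (Fin 2) (ZMod (5 ^ (m + 1))),
      red h = red h' → f h = 0 → f h' = 0 → h = h' := by
    intro h h' hhh' hfh hfh'
    have hx : red (h⁻¹ * h') = 1 := by rw [map_mul, map_inv, hhh', inv_mul_cancel]
    have hfinv : f h⁻¹ = 0 := by
      have h' := hf h⁻¹ h
      rw [inv_mul_cancel, f_one, hfh] at h'
      simpa using h'.symm
    have hfx : f (h⁻¹ * h') = 0 := by
      rw [hf, hfinv, hfh']; simp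
    obtain ⟨X, -, hxκ, hfX⟩ := hfK _ hx
    rw [hfx] at hfX
    have hX0 : X = 0 := by
      rcases smul_eq_zero.1 hfX.symm with h0 | h0
      · exact absurd h0 hc0
      · exact h0
    rw [hX0, hκzero] at hxκ
    exact (eq_of_inv_mul_eq_one hxκ)
  -- lifts exist (Andrianov–Zhuravlev via `SL₂(ℤ)`)
  have hsurj : ∀ a : Matrix.SpecialLinearGroup (Fin 2) (ZMod (5 ^ m)),
      ∃ g : Matrix.SpecialLinearGroup (Fin 2) (ZMod (5 ^ (m + 1))), red g = a := by
    intro a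
    obtain ⟨V, hV⟩ :=
      Literature.LinearAlgebra.Matrix.IntegerSpecialLinear.exists_specialLinearGroup_map_intCast_eq (5 ^ m) a
    refine ⟨Matrix.SpecialLinearGroup.map (Int.castRingHom (ZMod (5 ^ (m + 1)))) V, ?_⟩
    rw [← hV]
    apply Subtype.ext
    ext i j
    simp only [hred, Matrix.SpecialLinearGroup.map_apply_coe, RingHom.mapMatrix_apply, Matrix.map_apply,
      eq_intCast, map_intCast]
  choose lift hlift using hsurj
  -- the corrected lift
  have hPQ : ∀ g : Matrix.SpecialLinearGroup (Fin 2) (ZMod (5 ^ (m + 1))),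
      ((ρ g : Matrix.SpecialLinearGroup (Fin 2) (ZMod 5)) : Matrix (Fin 2) (Fin 2) (ZMod 5)) *
        (((ρ g)⁻¹ : Matrix.SpecialLinearGroup (Fin 2) (ZMod 5)) : Matrix (Fin 2) (Fin 2) (ZMod 5)) = 1 := by
    intro g
    have h := congrArg (fun x : Matrix.SpecialLinearGroup (Fin 2) (ZMod 5) => (x : Matrix (Fin 2) (Fin 2) (ZMod 5)))
      (mul_inv_cancel (ρ g))
    simpa only [Matrix.SpecialLinearGroup.coe_mul, Matrix.SpecialLinearGroup.coe_one] using h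
  have hQP : ∀ g : Matrix.SpecialLinearGroup (Fin 2) (ZMod (5 ^ (m + 1))),
      (((ρ g)⁻¹ : Matrix.SpecialLinearGroup (Fin 2) (ZMod 5)) : Matrix (Fin 2) (Fin 2) (ZMod 5)) *
        ((ρ g : Matrix.SpecialLinearGroup (Fin 2) (ZMod 5)) : Matrix (Fin 2) (Fin 2) (ZMod 5)) = 1 := by
    intro g
    have h := congrArg (fun x : Matrix.SpecialLinearGroup (Fin 2) (ZMod 5) => (x : Matrix (Fin 2) (Fin 2) (ZMod 5)))
      (inv_mul_cancel (ρ g))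
    simpa only [Matrix.SpecialLinearGroup.coe_mul, Matrix.SpecialLinearGroup.coe_one] using h
  let Z : Matrix.SpecialLinearGroup (Fin 2) (ZMod (5 ^ m)) → Matrix (Fin 2) (Fin 2) (ZMod 5) := fun a =>
    -(c⁻¹ • ((((ρ (lift a))⁻¹ : Matrix.SpecialLinearGroup (Fin 2) (ZMod 5)) : Matrix (Fin 2) (Fin 2) (ZMod 5)) *
      f (lift a) * ((ρ (lift a) : Matrix.SpecialLinearGroup (Fin 2) (ZMod 5)) : Matrix (Fin 2) (Fin 2) (ZMod 5))))
  have hZtr : ∀ a, Matrix.trace (Z a) = 0 := by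
    intro a
    simp only [Z, Matrix.trace_neg, Matrix.trace_smul, smul_eq_mul]
    rw [Matrix.trace_mul_cycle, hPQ, Matrix.one_mul, htr, mul_zero, neg_zero]
  let s₀ : Matrix.SpecialLinearGroup (Fin 2) (ZMod (5 ^ m)) → Matrix.SpecialLinearGroup (Fin 2) (ZMod (5 ^ (m + 1))) :=
    fun a => lift a * κ (Z a)
  have hs₀red : ∀ a, red (s₀ a) = a := by
    intro a; show red (lift a * κ (Z a)) = a; rw [map_mul, hredκ, mul_one, hlift]
  have hs₀f : ∀ a, f (s₀ a) = 0 := by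
    intro a
    show f (lift a * κ (Z a)) = 0
    rw [hf, ← hψ, hc _ (hZtr a)]
    simp only [Z, smul_neg, smul_smul, mul_inv_cancel₀ hc0, one_smul, Matrix.mul_neg, Matrix.neg_mul]
    rw [← mul_assoc, ← mul_assoc, hPQ, one_mul, mul_assoc, hPQ, mul_one, add_neg_cancel]
  let s : Matrix.SpecialLinearGroup (Fin 2) (ZMod (5 ^ m)) →* Matrix.SpecialLinearGroup (Fin 2) (ZMod (5 ^ (m + 1))) :=
    { toFun := s₀
      map_one' := hU _ _ (by rw [hs₀red, map_one]) (hs₀f 1) f_one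
      map_mul' := fun a b => hU _ _ (by rw [hs₀red, map_mul, hs₀red, hs₀red]) (hs₀f _) (by
        rw [hf, hs₀f, hs₀f]; simp) }
  exact not_exists_section_SL2 m hm ⟨s, hs₀red⟩

end prop36

end Summit.BirchSwinnertonDyer.BirchSwinnertonDyer.Theorems.GL2F5AdjointBricks
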